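import Mathlib
import Literature.NumberTheory.Transcendental.KZSemiCanonicalReductionDimOne
import Literature.NumberTheory.Transcendental.SemialgebraicGrounding
import Literature.NumberTheory.Transcendental.EllIterRep
import Literature.ModelTheory.ExponentialFields.TarskiSeidenbergProofs

/-!
# `TateLifting` (stmt-KontsevichZagierPeriods-9129), line `Sketch` — stub `stub_dimOneCells`

1-CELLS WITH ALGEBRAIC BREAK POINTS. A one-dimensional Kontsevich–Zagier representation
`r = [σ, f]` with BOUNDED domain `σ ⊆ ℝ¹` differs by relations from the sum of its restrictions to
finitely many open intervals `(uⱼ, vⱼ)` with real-algebraic end points, contained in `σ`: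
`[r] − Σⱼ [r|(uⱼ, vⱼ)] ∈ relations`.

Proof (o-minimality of the line, inside the calculus).
* Present `σ` by simultaneous sign conditions on a finite family `Q ⊆ ℚ[x₀]`
  (`IsSemialgebraic.exists_eq_setOf_signVec_mem`). Reading each `q ∈ Q` as a univariate rational
  polynomial, membership in `σ` is locally constant off the finite set of real roots of the
  non-zero ones (continuity of polynomials), and these roots are algebraic over `ℚ`
  (`DimOne.cells_exists_finset_locallyConst`).
* Add the two integer bounds `±C` of the bounded domain to this finite set `R`. Every complementary
  open interval ("gap", `FibreLength.gap`) of `R` is contained in the trace of `σ` or disjoint from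
  it (connectedness, `FibreLength.subset_or_disjoint_of_isPreconnected`); the gaps inside the trace
  are inner gaps `(Rᵢ₋₁, Rᵢ)`, pairwise disjoint, and cover the trace off `R`
  (`DimOne.exists_cells`).
* The cells `{x | x₀ ∈ (uⱼ, vⱼ)}` are `ℚ`-semialgebraic (algebraic end points), the rest of `σ` lies
  over the finite, hence null, set `R`, so iterated domain additivity
  (`KZ.of_sub_sum_of_mem_relations`, rule (1)) concludes.

References: M. Kontsevich, D. Zagier, *Periods* (2001), §1.2, rule (1); J. Bochnak, M. Coste,
M.-F. Roy, *Real Algebraic Geometry* (1998), §2.3 (semialgebraic subsets of the line);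
L. van den Dries, *Tame Topology and O-minimal Structures* (1998), Ch. 1 (3.3).
-/

noncomputable section

open MeasureTheory Set Filter Topology
open Literature.ModelTheory.ExponentialFields
open Literature.NumberTheory.Transcendental

namespace Summit.KontsevichZagierPeriods.InverseLandau

namespace DimOne

/-! ### Switching points of a `ℚ`-semialgebraic subset of the line are algebraic -/

/-- Univariate reading of a polynomial in the single variable `x₀` with rational coefficients:
`q(t) = p(t)` for a rational univariate `p`. [folklore] -/
theorem cells_exists_aeval_eq (q : MvPolynomial (Fin 1) ℚ) :
    ∃ p : Polynomial ℚ, ∀ t : ℝ,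
      MvPolynomial.aeval (fun _ : Fin 1 => t) q = Polynomial.aeval t p := by
  refine ⟨MvPolynomial.aeval (fun _ : Fin 1 => (Polynomial.X : Polynomial ℚ)) q, fun t => ?_⟩
  rw [← AlgHom.comp_apply, MvPolynomial.comp_aeval]
  simp

/-- **Finitely many algebraic switching points.** For a `ℚ`-semialgebraic `S ⊆ ℝ¹` there is a
finite set `R` of real numbers, algebraic over `ℚ`, off which membership of `(t) ∈ S` is a locally
constant function of `t`: the real roots of the non-zero univariate rational polynomials of a
sign-condition presentation of `S` (cf. `FibreLength.exists_card_le_locallyConst`).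
[cite: BochnakCosteRoy1998, §2.3] -/
theorem cells_exists_finset_locallyConst {S : Set (Fin 1 → ℝ)} (hS : IsSemialgebraic ℚ S) :
    ∃ R : Finset ℝ, (∀ c ∈ R, IsAlgebraic ℚ c) ∧
      ∀ u ∉ (R : Set ℝ), ∀ᶠ u' in 𝓝 u, ((fun _ : Fin 1 => u') ∈ S ↔ (fun _ : Fin 1 => u) ∈ S) := by
  classical
  obtain ⟨Q, T, rfl⟩ := hS.exists_eq_setOf_signVec_mem
  choose p hp using fun q : MvPolynomial (Fin 1) ℚ => cells_exists_aeval_eq q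
  refine ⟨Q.biUnion fun q => ((p q).aroots ℝ).toFinset, fun c hc => ?_, fun u hu => ?_⟩
  · obtain ⟨q, -, hq⟩ := Finset.mem_biUnion.1 hc
    have h := Polynomial.mem_aroots.1 (Multiset.mem_toFinset.1 hq)
    exact ⟨p q, h.1, h.2⟩
  · have hne : ∀ q ∈ Q, p q ≠ 0 → Polynomial.aeval u (p q) ≠ 0 := by
      intro q hq hq0 h0
      apply hu
      rw [Finset.mem_coe, Finset.mem_biUnion]
      exact ⟨q, hq, Multiset.mem_toFinset.2 (Polynomial.mem_aroots.2 ⟨hq0, h0⟩)⟩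
    have hloc : ∀ q ∈ Q, ∀ᶠ u' in 𝓝 u,
        SignType.sign (Polynomial.aeval u' (p q)) = SignType.sign (Polynomial.aeval u (p q)) := by
      intro q hq
      by_cases hq0 : p q = 0
      · simp [hq0]
      · have hcont : ContinuousAt (fun u' : ℝ => Polynomial.aeval u' (p q)) u :=
          (Polynomial.continuous_aeval (p q)).continuousAt
        rcases lt_trichotomy (Polynomial.aeval u (p q)) 0 with hlt | heq | hgt
        · filter_upwards [hcont.eventually (gt_mem_nhds hlt)] with u' hu'
          rw [sign_neg hu', sign_neg hlt]
        · exact (hne q hq hq0 heq).elim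
        · filter_upwards [hcont.eventually (lt_mem_nhds hgt)] with u' hu'
          rw [sign_pos hu', sign_pos hgt]
    filter_upwards [(Q.eventually_all).2 hloc] with u' hu'
    have e : (fun q : Q => SignType.sign (MvPolynomial.aeval (fun _ : Fin 1 => u')
        (q : MvPolynomial (Fin 1) ℚ))) =
        fun q : Q => SignType.sign (MvPolynomial.aeval (fun _ : Fin 1 => u)
          (q : MvPolynomial (Fin 1) ℚ)) := by
      funext q
      rw [hp, hp, hu' q q.2]
    show (fun q : Q => SignType.sign (MvPolynomial.aeval (fun _ : Fin 1 => u')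
        (q : MvPolynomial (Fin 1) ℚ))) ∈ T ↔
      (fun q : Q => SignType.sign (MvPolynomial.aeval (fun _ : Fin 1 => u)
        (q : MvPolynomial (Fin 1) ℚ))) ∈ T
    rw [e]

/-! ### Cells of a finite subset of the line -/

/-- An inner gap of a finite set `R ⊆ ℝ` is the open interval between two consecutive points of
the increasing enumeration of `R`. [folklore] -/
theorem cells_gap_eq_Ioo (R : Finset ℝ) (i : Fin (R.card + 1)) (h0 : 0 < (i : ℕ))
    (hi : (i : ℕ) < R.card) :
    FibreLength.gap R i =
      Ioo (FibreLength.enum R ⟨(i : ℕ) - 1, by omega⟩) (FibreLength.enum R ⟨i, hi⟩) := by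
  ext w
  constructor
  · intro hw
    exact ⟨hw.1 ⟨(i : ℕ) - 1, by omega⟩ (Nat.sub_lt h0 Nat.one_pos), hw.2 ⟨i, hi⟩ le_rfl⟩
  · intro hw
    refine ⟨fun k hk => lt_of_le_of_lt ((FibreLength.enum R).monotone (Fin.le_def.2 ?_)) hw.1,
      fun k hk => lt_of_lt_of_le hw.2 ((FibreLength.enum R).monotone (Fin.le_def.2 hk))⟩
    show (k : ℕ) ≤ (i : ℕ) - 1
    omega

/-- **Cells.** Let `R ⊆ ℝ` be finite, `A ⊆ [a, b]` with `a, b ∈ R`, and suppose membership in `A`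
is locally constant off `R`. Then there are finitely many pairwise disjoint open intervals with end
points in `R`, contained in `A`, which cover `A` off `R`: the complementary intervals of `R` inside
`A` (each complementary interval is inside `A` or disjoint from it, by connectedness).
[cite: Dries1998, Ch. 1 (3.3)] -/
theorem exists_cells {A : Set ℝ} {R : Finset ℝ} {a b : ℝ} (ha : a ∈ R) (hb : b ∈ R)
    (hA : A ⊆ Icc a b) (hloc : ∀ u ∉ (R : Set ℝ), ∀ᶠ u' in 𝓝 u, u' ∈ A ↔ u ∈ A) :
    ∃ (k : ℕ) (u v : Fin k → ℝ), (∀ j, u j ∈ R ∧ v j ∈ R ∧ u j < v j) ∧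
      (∀ j, Ioo (u j) (v j) ⊆ A) ∧
      Pairwise (fun j j' => Disjoint (Ioo (u j) (v j)) (Ioo (u j') (v j'))) ∧
      A \ (⋃ j, Ioo (u j) (v j)) ⊆ R := by
  classical
  -- every gap is inside `A` or disjoint from `A`
  have hgapA : ∀ i : Fin (R.card + 1), FibreLength.gap R i ⊆ A ∨ Disjoint (FibreLength.gap R i) A :=
    fun i => FibreLength.subset_or_disjoint_of_isPreconnected (FibreLength.isPreconnected_gap i)
      fun u hu => hloc u (FibreLength.not_mem_of_mem_gap hu)
  -- non-empty gaps inside `A` are inner gaps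
  have hinner : ∀ i : Fin (R.card + 1), FibreLength.gap R i ⊆ A → (FibreLength.gap R i).Nonempty →
      0 < (i : ℕ) ∧ (i : ℕ) < R.card := by
    rintro i hiA ⟨w, hw⟩
    obtain ⟨ka, hka⟩ := FibreLength.exists_enum_eq ha
    obtain ⟨kb, hkb⟩ := FibreLength.exists_enum_eq hb
    have hwab := hA (hiA hw)
    constructor
    · by_contra h
      have h1 := hw.2 ka (by omega)
      rw [hka] at h1
      exact absurd hwab.1 (not_le.2 h1)
    · by_contra h
      have hkb' := kb.isLt
      have h1 := hw.1 kb (by omega)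
      rw [hkb] at h1
      exact absurd hwab.2 (not_le.2 h1)
  set G : Finset (Fin (R.card + 1)) :=
    Finset.univ.filter fun i => FibreLength.gap R i ⊆ A ∧ (FibreLength.gap R i).Nonempty with hG
  have hGspec : ∀ i ∈ G, FibreLength.gap R i ⊆ A ∧ (FibreLength.gap R i).Nonempty := fun i hi =>
    (Finset.mem_filter.1 hi).2
  have hdata : ∀ i ∈ G,
      ∃ lo up : ℝ, lo ∈ R ∧ up ∈ R ∧ lo < up ∧ FibreLength.gap R i = Ioo lo up := by
    intro i hi
    obtain ⟨h0, hic⟩ := hinner i (hGspec i hi).1 (hGspec i hi).2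
    exact ⟨FibreLength.enum R ⟨(i : ℕ) - 1, by omega⟩, FibreLength.enum R ⟨i, hic⟩,
      FibreLength.enum_mem _, FibreLength.enum_mem _,
      (FibreLength.enum R).strictMono (Fin.lt_def.2 (Nat.sub_lt h0 Nat.one_pos)),
      cells_gap_eq_Ioo R i h0 hic⟩
  choose! lo up hloR hupR hlt hgap using hdata
  set e : Fin G.card ≃ G := G.equivFin.symm with he
  refine ⟨G.card, fun j => lo (e j), fun j => up (e j),
    fun j => ⟨hloR _ (e j).2, hupR _ (e j).2, hlt _ (e j).2⟩, fun j => ?_, ?_, ?_⟩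
  · rw [← hgap _ (e j).2]
    exact (hGspec _ (e j).2).1
  · intro j j' hne
    have hne' : ((e j : Fin (R.card + 1)) : ℕ) ≠ ((e j' : Fin (R.card + 1)) : ℕ) := fun h =>
      hne (e.injective (Subtype.ext (Fin.ext h)))
    show Disjoint (Ioo (lo (e j)) (up (e j))) (Ioo (lo (e j')) (up (e j')))
    rw [← hgap _ (e j).2, ← hgap _ (e j').2]
    rcases lt_or_gt_of_ne hne' with h | h
    · exact Set.disjoint_left.2 fun w hw hw' => lt_irrefl _ (FibreLength.lt_of_mem_gap h hw hw')
    · exact Set.disjoint_left.2 fun w hw hw' => lt_irrefl _ (FibreLength.lt_of_mem_gap h hw' hw)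
  · intro t ht
    by_contra htR
    obtain ⟨i, hti⟩ := FibreLength.exists_mem_gap htR
    have hiA : FibreLength.gap R i ⊆ A :=
      (hgapA i).resolve_right fun h => Set.disjoint_left.1 h hti ht.1
    have hiG : i ∈ G := Finset.mem_filter.2 ⟨Finset.mem_univ _, hiA, t, hti⟩
    have hei : (e (e.symm ⟨i, hiG⟩) : Fin (R.card + 1)) = i := by
      rw [Equiv.apply_symm_apply]
    refine ht.2 (mem_iUnion.2 ⟨e.symm ⟨i, hiG⟩, ?_⟩)
    show t ∈ Ioo (lo (e (e.symm ⟨i, hiG⟩))) (up (e (e.symm ⟨i, hiG⟩)))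
    rw [hei, ← hgap i hiG]
    exact hti

end DimOne

/-! ### The stub -/

/-- **1-cells with algebraic break points** (stub `stub_dimOneCells` of the line `Sketch` of the
crux `TateLifting`): a one-dimensional Kontsevich–Zagier representation `r = [σ, f]` with bounded
domain differs by relations from the sum of its restrictions to finitely many open intervals
`(uⱼ, vⱼ) ⊆ σ` with real-algebraic end points. Membership in the `ℚ`-semialgebraic `σ ⊆ ℝ¹` is
locally constant off the finitely many (algebraic) real roots of the non-zero rational polynomials
of a sign-condition presentation (`DimOne.cells_exists_finset_locallyConst`); adding two integer
bounds of the domain, the complementary intervals inside `σ` are the cells (`DimOne.exists_cells`);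
the rest of `σ` is finite, hence null, and iterated domain additivity (rule (1),
`KZ.of_sub_sum_of_mem_relations`) concludes. [cite: KontsevichZagier2001, §1.2 rule (1)] -/
theorem tateLifting_dimOneCells :
    ∀ r : KZ.IntegralRep 1, Bornology.IsBounded r.domain →
      ∃ (k : ℕ) (u v : Fin k → ℝ) (ρ : Fin k → KZ.IntegralRep 1),
        (∀ j, IsAlgebraic ℚ (u j) ∧ IsAlgebraic ℚ (v j) ∧ u j < v j) ∧
        (∀ j, (ρ j).domain = {x | x 0 ∈ Set.Ioo (u j) (v j)}) ∧
        (∀ j, (ρ j).domain ⊆ r.domain) ∧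
        (∀ j, (ρ j).integrand = r.integrand) ∧
        KZ.of r - ∑ j, KZ.of (ρ j) ∈ KZ.relations := by
  intro r hb
  classical
  -- the trace of the domain on the line
  set A : Set ℝ := {t | (fun _ : Fin 1 => t) ∈ r.domain} with hA
  have hdomA : ∀ x : Fin 1 → ℝ, x ∈ r.domain ↔ x 0 ∈ A := fun x => by
    show x ∈ r.domain ↔ (fun _ => x 0) ∈ r.domain
    rw [← KZ.eq_const_apply_zero x]
  -- an integer bound of the domain
  obtain ⟨C, hC⟩ : ∃ C : ℕ, ∀ x ∈ r.domain, |x 0| < C := by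
    obtain ⟨ρ₀, hρ₀⟩ := (Metric.isBounded_iff_subset_ball (0 : Fin 1 → ℝ)).1 hb
    obtain ⟨C, hC⟩ := exists_nat_gt ρ₀
    refine ⟨C, fun x hx => ?_⟩
    have h1 : ‖x‖ < ρ₀ := mem_ball_zero_iff.1 (hρ₀ hx)
    have h2 : |x 0| ≤ ‖x‖ := by
      have h := norm_le_pi_norm x 0
      rwa [Real.norm_eq_abs] at h
    linarith
  have hCalg : IsAlgebraic ℚ (C : ℝ) := isAlgebraic_nat C
  -- the switching points of the domain, and the two bounds
  obtain ⟨R₀, hR₀alg, hR₀loc⟩ := DimOne.cells_exists_finset_locallyConst r.isSemialgebraic_domain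
  set R : Finset ℝ := insert (-(C : ℝ)) (insert (C : ℝ) R₀) with hR
  have hRalg : ∀ c ∈ R, IsAlgebraic ℚ c := by
    intro c hc
    simp only [hR, Finset.mem_insert] at hc
    rcases hc with rfl | rfl | hc
    exacts [hCalg.neg, hCalg, hR₀alg c hc]
  have hAI : A ⊆ Icc (-(C : ℝ)) C := fun t ht => by
    have h := abs_lt.1 (hC _ ht)
    exact ⟨h.1.le, h.2.le⟩
  have hloc : ∀ u ∉ (R : Set ℝ), ∀ᶠ u' in 𝓝 u, u' ∈ A ↔ u ∈ A := fun u hu =>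
    hR₀loc u fun h => hu (Finset.mem_coe.2
      (Finset.mem_insert_of_mem (Finset.mem_insert_of_mem (Finset.mem_coe.1 h))))
  obtain ⟨k, u, v, huv, hsubA, hdisj, hcov⟩ := DimOne.exists_cells (Finset.mem_insert_self _ _)
    (Finset.mem_insert_of_mem (Finset.mem_insert_self _ _)) hAI hloc
  -- the cells of `ℝ¹` and the restrictions of `r` to them
  have halg : ∀ j, IsAlgebraic ℚ (u j) ∧ IsAlgebraic ℚ (v j) ∧ u j < v j := fun j =>
    ⟨hRalg _ (huv j).1, hRalg _ (huv j).2.1, (huv j).2.2⟩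
  have hsa : ∀ j, IsSemialgebraic ℚ {x : Fin 1 → ℝ | x 0 ∈ Ioo (u j) (v j)} := fun j =>
    (KZ.isSemialgebraic_setOf_const_lt_apply (halg j).1 0).inter
      (KZ.isSemialgebraic_setOf_apply_lt_const (halg j).2.1 0)
  have hsub : ∀ j, {x : Fin 1 → ℝ | x 0 ∈ Ioo (u j) (v j)} ⊆ r.domain := fun j x hx =>
    (hdomA x).2 (hsubA j hx)
  refine ⟨k, u, v, fun j => r.restrict _ (hsa j) (hsub j), halg, fun j => rfl, hsub, fun j => rfl,
    ?_⟩
  -- rule (1): the cells cover the domain off the null set over `R` and are pairwise disjoint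
  have hN : volume {x : Fin 1 → ℝ | x 0 ∈ (R : Set ℝ)} = 0 := by
    rw [show {x : Fin 1 → ℝ | x 0 ∈ (R : Set ℝ)} = ⋃ c ∈ (R : Set ℝ), {x : Fin 1 → ℝ | x 0 = c} by
      ext x; simp, measure_biUnion_null_iff R.countable_toSet]
    intro c _
    rw [volume_pi]
    exact Measure.pi_hyperplane (α := fun _ : Fin 1 => ℝ) (fun _ => volume) 0 c
  refine KZ.of_sub_sum_of_mem_relations Finset.univ r _ (fun j _ => ?_) (fun j _ _ _ => rfl) ?_ ?_
  · rw [KZ.IntegralRep.domain_restrict, Set.sdiff_eq_empty.2 (hsub j), measure_empty]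
  · refine measure_mono_null (fun x hx => ?_) hN
    refine hcov ⟨(hdomA x).1 hx.1, fun h => hx.2 ?_⟩
    obtain ⟨j, hj⟩ := mem_iUnion.1 h
    exact mem_iUnion₂.2 ⟨j, Finset.mem_univ _, hj⟩
  · intro i _ j _ hij
    rw [show (r.restrict _ (hsa i) (hsub i)).domain ∩ (r.restrict _ (hsa j) (hsub j)).domain = ∅
      from Set.eq_empty_of_forall_notMem fun x hx => Set.disjoint_left.1 (hdisj hij) hx.1 hx.2,
      measure_empty]

end Summit.KontsevichZagierPeriods.InverseLandau
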